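import Literature.NumberTheory.EllipticCurves.AnalyticRankProofs
import HarnessLib

/-!
# Discharge of `WeierstrassCurve.analyticRank_eq_zero_iff` and `WeierstrassCurve.leadingLCoeff_ne_zero`

Sibling proof file of `Literature.NumberTheory.EllipticCurves.AnalyticRank` (family `bsd`, trunk
T-ELLARITH). Both named facts are the elementary complex analysis of the order of vanishing
`r = ord_{s=1} L(W,s)` (Birch–Swinnerton-Dyer, J. reine angew. Math. 218 (1965); Wiles, *The Birch
and Swinnerton-Dyer conjecture*, Clay 2006, p. 2: "`L(C,s) = c (s-1)^r + ` higher order terms,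
`c ≠ 0`"), given the one analytic input already discharged in
`Literature.NumberTheory.EllipticCurves.AnalyticRankProofs`: the entire continuation
`W.entireLFunction` is not identically zero near `s = 1`
(`WeierstrassCurve.entireLFunction_not_eventuallyEq_zero_holds`), so that
`analyticOrderAt W.entireLFunction 1` is a genuine natural number `r = W.analyticRank`.

* `WeierstrassCurve.analyticRank_eq_zero_iff_holds`: `r = 0 ↔ L(W,1) ≠ 0` (the proof preserved in
  the comment of `AnalyticRank.lean`, now sorry-free);
* `WeierstrassCurve.leadingLCoeff_ne_zero_holds`: `L^{(r)}(W,1)/r! ≠ 0`, from Mathlib's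
  `natCast_le_analyticOrderAt_iff_iteratedDeriv_eq_zero` ("`n ≤ ord` iff the first `n`
  derivatives vanish") applied with `n = r` and `n = r + 1`.

Users in the tree take these facts as hypotheses (`Literature.NumberTheory.EllipticCurves.Wiles2000.weakBSD_of_analyticRank_eq`,
`Literature.CM.analyticRank_eq_zero_iff_L_one_ne_zero`, …); they can now be fed the `_holds` theorems.

## References

* [BirchSwinnertonDyer1965] B. J. Birch, H. P. F. Swinnerton-Dyer, *Notes on elliptic curves. II*,
  J. reine angew. Math. 218 (1965), 79–108.
* [Wiles2000] A. Wiles, *The Birch and Swinnerton-Dyer conjecture*, Clay (2000/2006), p. 2.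

## Design

Deliberate dot-notation extensions of Mathlib's `WeierstrassCurve` namespace, exactly as the facts
they discharge; the hypothesis `[W.IsElliptic]` quantified inside the facts is not used.
-/

noncomputable section

open scoped Classical

namespace WeierstrassCurve

open Filter Topology

variable {K : Type*} [Field K] [NumberField K] {W : WeierstrassCurve K}

/-- If `L(W,s)` has an entire continuation, its order of vanishing at `s = 1` is finite:
`analyticOrderAt W.entireLFunction 1 ≠ ⊤`, i.e. the continuation is not identically zero near `1`
(`entireLFunction_not_eventuallyEq_zero_holds`, whose statement carries the unused hypothesis
`[W.IsElliptic]`; Silverman AEC App. C §16). [folklore] -/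
theorem analyticOrderAt_entireLFunction_ne_top [W.IsElliptic] (h : W.HasEntireLFunction) :
    analyticOrderAt W.entireLFunction 1 ≠ ⊤ := by
  rw [Ne, analyticOrderAt_eq_top]
  exact W.entireLFunction_not_eventuallyEq_zero_holds h

/-- If `L(W,s)` has an entire continuation, the analytic rank *is* the order of vanishing:
`(W.analyticRank : ℕ∞) = analyticOrderAt W.entireLFunction 1` (Birch–Swinnerton-Dyer 1965).
[folklore] -/
theorem analyticRank_eq_analyticOrderAt [W.IsElliptic] (h : W.HasEntireLFunction) :
    (W.analyticRank : ℕ∞) = analyticOrderAt W.entireLFunction 1 := by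
  unfold analyticRank analyticOrderNatAt
  exact ENat.coe_toNat (W.analyticOrderAt_entireLFunction_ne_top h)

/-- **Discharge of the named fact `WeierstrassCurve.analyticRank_eq_zero_iff`**
(Birch–Swinnerton-Dyer 1965): if `L(W,s)` has an entire continuation then
`ord_{s=1} L(W,s) = 0 ↔ L(W,1) ≠ 0`. The continuation is analytic at `1` and not identically
zero near `1`, so its order there is the natural number `W.analyticRank`, which vanishes iff the
value at `1` is nonzero (`AnalyticAt.analyticOrderAt_eq_zero`). This is the proof preserved in
`AnalyticRank.lean`, made sorry-free by `entireLFunction_not_eventuallyEq_zero_holds`.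
[cite: BirchSwinnertonDyer1965] -/
theorem analyticRank_eq_zero_iff_holds : analyticRank_eq_zero_iff (W := W) := by
  intro _ h
  have han : AnalyticAt ℂ W.entireLFunction 1 :=
    (W.differentiable_entireLFunction h).analyticAt 1
  rw [← han.analyticOrderAt_eq_zero, ← W.analyticRank_eq_analyticOrderAt h]
  exact_mod_cast Iff.rfl

/-- **Discharge of the named fact `WeierstrassCurve.leadingLCoeff_ne_zero`**
(Birch–Swinnerton-Dyer 1965; Wiles, Clay 2006, p. 2: `L(C,s) = c(s-1)^r + …` with `c ≠ 0`): if
`L(W,s)` has an entire continuation then `L^{(r)}(W,1)/r! ≠ 0` for `r = ord_{s=1} L(W,s)`. By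
`natCast_le_analyticOrderAt_iff_iteratedDeriv_eq_zero`, `n ≤ ord` iff the derivatives of order
`< n` vanish at `1`; with `n = r + 1 > ord` some derivative of order `≤ r` is nonzero, and with
`n = r` those of order `< r` vanish, so `L^{(r)}(W,1) ≠ 0`. [cite: BirchSwinnertonDyer1965] -/
theorem leadingLCoeff_ne_zero_holds : leadingLCoeff_ne_zero (W := W) := by
  intro _ h
  have han : AnalyticAt ℂ W.entireLFunction 1 :=
    (W.differentiable_entireLFunction h).analyticAt 1
  have hr := W.analyticRank_eq_analyticOrderAt h
  have hderiv : iteratedDeriv W.analyticRank W.entireLFunction 1 ≠ 0 := by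
    intro h0
    have hle : ((W.analyticRank + 1 : ℕ) : ℕ∞) ≤ analyticOrderAt W.entireLFunction 1 := by
      rw [natCast_le_analyticOrderAt_iff_iteratedDeriv_eq_zero han]
      intro i hi
      rcases Nat.lt_succ_iff_lt_or_eq.mp hi with hi | rfl
      · exact (natCast_le_analyticOrderAt_iff_iteratedDeriv_eq_zero han).mp hr.le i hi
      · exact h0
    rw [← hr] at hle
    exact absurd (by exact_mod_cast hle : W.analyticRank + 1 ≤ W.analyticRank) (by omega)
  unfold leadingLCoeff
  exact div_ne_zero hderiv (by exact_mod_cast (Nat.factorial_pos _).ne')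

end WeierstrassCurve

end
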